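import Mathlib
import HarnessLib
import Summits.HubbardSuperconductivity.HubbardSuperconductivity.Theorems.KLProgrammeKLRegimeAlphaWtFlowDeep
import Summits.HubbardSuperconductivity.HubbardSuperconductivity.Theorems.KLProgrammeKLRegimeSplitFlowPieceOscJets
import Summits.HubbardSuperconductivity.HubbardSuperconductivity.Theorems.KLProgrammeKLRegimeSplitStagePieces
import Summits.HubbardSuperconductivity.HubbardSuperconductivity.Theorems.KLProgrammeKLRegimeCountertermMuFlowExt
import Summits.HubbardSuperconductivity.HubbardSuperconductivity.Theorems.KLProgrammeKLRegimeSplitModelCongr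

/-!
# K3 ENGINE child (stmt-HubbardSuperconductivity-20437), stub (b), (F1)/(c-D) telescope: **the MEAN-FREE BASE FRAME is an admissible frame** —
# `FrameOK R♭ U n_β μ (K_{m₀} ⊖ c)`, `c = Σ_{m₀≤m<n} klAngularMean ν_m`, from the CURRENT history alone; and the band-shift congruences that identify
# the objects at `(μ′, K̊_{m₀})` (the (K5′) chain's level and mean-free frame) with those at `(μ, K_{m₀} ⊖ c)`

Cell `gate-hubbard-kl`, seat p3 (g11); item «MF-BASE» (KL STATUS 2026-08-27 23:45Z; pen (R68e) base of record `m₀(j) = 2j + 5 + ⌈log₄|U|⁻¹⌉`).  The (F1)/(c-D)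
telescope of hubbard-kl-k3c3-p2 (`…EngineSliceSpaceMomentOscCD`, F1-DESIGN.md §1) runs at the shifted level `μ′ = μ + s_n`, `s_n = −Σ_{m<n} mean_m`
(`mean_m = klAngularMean (klLocalPart … K_m m)`), through the mean-free frames `K̊_m = K_m ⊖ s_m` (`frameLevel_klFlowFrameU_eq_shift`: at `m = n` this IS the band of
`K_n` at `μ`).  Its BASE at `m₀ < n` is therefore NOT a flow frame: `frameLevel μ′ K̊_{m₀} = frameLevel μ K♯`, **`K♯ := K_{m₀} ⊖ c`, `c := Σ_{m₀≤m<n} mean_m`**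
(`|mean_m| ≤ cr·|U|·Λ_m²/e₀`, `abs_klAngularMean_localPart_le_of_renormalisedAtF` on the history's `RenormalisedAtF` slots).  The weighted-row doors
(`alphaWt_klSliceCov_bgmFat_of_thresholds`, p3) want `μ ∈ klWindowC` (no slack for `μ′` at the window's edges) and `FrameOK … μ K`; this file supplies both
at `(μ, K♯)`:

* §1 **band-shift congruences**: `nambuXiCT L μ K = nambuXiCT L μ′ K′ ⇒` equal `nambuDenCT`, `nambuPropagatorCT`, `nambuTwoPointCT`, `hubbardTwoPointCT`,
  `hubbardCovarianceCT`, `hubbardCutoffWeightCT`, `hubbardCovAboveCT`, `hubbardCovSliceCT` (every CT object reads `(μ, K)` only through the band; twin of p2's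
  `…SplitModelCongr` §1, which fixes `μ`); `nambuXiCT_level_shift` (`nambuXiCT L (μ + a) K = nambuXiCT L μ (K ⊖ (−a))`) and
  **`nambuXiCT_meanFree_eq_base`**: `nambuXiCT L μ′ K̊_{m₀} = nambuXiCT L μ K♯`;
* §2 **`frameOK_meanFreeBase`**: under `R.WF2`, `μ ∈ klWindowC`, `0 < U ≤ 1`, the own door `U ≤ 1/(2¹²·(Gfr₀ + Gfr₁ + cr + 1))`, `cc ≤ 1/(480(Gfr₂+1))`
  (below the symbol ceiling `κ₀/(12(Gfr₂+1))` of `klEngC₃3`), `IsKLRegime U cc (−n)`, `1 ≤ m₀ ≤ n ≤ n_β + 1` and `HistP klPredsV17F2 … 0 n`: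
  **`FrameOK R♭ U (nScales β) μ K♯`** with `R♭ := ⟨cr, cz, Gfr[0 ↦ Gfr₀ + cr·klE0]⟩` — pieces `{−piece_m}_{m<m₀}` ((I-F jets)) and the δμ constants
  `{−mean_m·1}_{m₀≤m<n}` (order-0 allowance `cr·klE0·|U|·16^{−m}`, no derivatives), `GeomConstants` by `geomConstants_of_pieces` AT `μ` with the three allowance
  sums re-derived (orders 0/1 from the door, the order-2 row `n·Gfr₂U² ≤ Gfr₂·cc/log 4` from `IsKLRegime`);
* the order-three data of `K♯` are those of `K_{m₀}` (`iteratedFDeriv_frameShift_meanFreeBase`, `iteratedFDeriv_frameLevel_meanFreeBase`).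

Everything is proved; no definitions (`R♭` is a structure literal), no sorry.  Nothing asserts superconductivity. [cite: BenfattoGiulianiMastropietro2006, §3 (3.2)–(3.8)]
-/

noncomputable section

namespace Summit.HubbardSuperconductivity.HubbardSuperconductivity.Theorems.KLRegimeSplit

set_option linter.dupNamespace false -- summit = problem name (single-conjunct summit), D-0017

open Real Finset Literature.MathematicalPhysics.QuantumLattice Literature.Probability.LatticeModels
open Literature.MathematicalPhysics.QuantumLattice.FermiRG
open Summit.HubbardSuperconductivity.HubbardSuperconductivity.Theorems.KLProgrammeLegKernels
open Summit.HubbardSuperconductivity.HubbardSuperconductivity.Theorems.DispersionFlow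
open Summit.HubbardSuperconductivity.HubbardSuperconductivity.Theorems.PerturbedFermiCurve
open Summit.HubbardSuperconductivity.HubbardSuperconductivity.Theorems.EngineV8

/-! ## §1 Band-shift congruences: the CT objects read `(μ, K)` only through `nambuXiCT L μ K` -/

section Band

variable {L M : ℕ} {μ μ' : ℝ} {K K' : TrigPolyC4v}

/-- Same band ⇒ same Nambu denominators. [folklore] -/
theorem nambuDenCT_eq_of_band (β h : ℝ) (hX : nambuXiCT L μ K = nambuXiCT L μ' K') :
    nambuDenCT L M β μ h K = nambuDenCT L M β μ' h K' := by
  funext k; simp only [nambuDenCT, hX]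

/-- Same band ⇒ same Nambu propagators. [folklore] -/
theorem nambuPropagatorCT_eq_of_band (β h : ℝ) (hX : nambuXiCT L μ K = nambuXiCT L μ' K') :
    nambuPropagatorCT L M β μ h K = nambuPropagatorCT L M β μ' h K' := by
  funext k; simp only [nambuPropagatorCT, hX, nambuDenCT_eq_of_band β h hX]

/-- Same band ⇒ same Nambu two-point table. [folklore] -/
theorem nambuTwoPointCT_eq_of_band (β h : ℝ) (hX : nambuXiCT L μ K = nambuXiCT L μ' K') :
    nambuTwoPointCT L M β μ h K = nambuTwoPointCT L M β μ' h K' := by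
  funext X Y; simp only [nambuTwoPointCT, nambuPropagatorCT_eq_of_band β h hX]

/-- Same band ⇒ same Hubbard two-point table. [folklore] -/
theorem hubbardTwoPointCT_eq_of_band (β h : ℝ) (hX : nambuXiCT L μ K = nambuXiCT L μ' K') :
    hubbardTwoPointCT L M β μ h K = hubbardTwoPointCT L M β μ' h K' := by
  funext X Y; simp only [hubbardTwoPointCT, nambuTwoPointCT_eq_of_band β h hX]

/-- Same band ⇒ same CT covariance. [folklore] -/
theorem hubbardCovarianceCT_eq_of_band (β h : ℝ) (hX : nambuXiCT L μ K = nambuXiCT L μ' K') :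
    hubbardCovarianceCT L M β μ h K = hubbardCovarianceCT L M β μ' h K' := by
  simp only [hubbardCovarianceCT, hubbardTwoPointCT_eq_of_band β h hX]

/-- Same band ⇒ same cutoff weights. [folklore] -/
theorem hubbardCutoffWeightCT_eq_of_band (β Λ : ℝ) (hX : nambuXiCT L μ K = nambuXiCT L μ' K') :
    hubbardCutoffWeightCT L M β μ K Λ = hubbardCutoffWeightCT L M β μ' K' Λ := by
  funext k; simp only [hubbardCutoffWeightCT, hX]

/-- Same band ⇒ same covariance above a scale. [folklore] -/
theorem hubbardCovAboveCT_eq_of_band (β h Λ : ℝ) (hX : nambuXiCT L μ K = nambuXiCT L μ' K') :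
    hubbardCovAboveCT L M β μ h K Λ = hubbardCovAboveCT L M β μ' h K' Λ := by
  simp only [hubbardCovAboveCT, hubbardCutoffWeightCT_eq_of_band β Λ hX, hubbardCovarianceCT_eq_of_band β h hX]

/-- **Same band ⇒ same slice covariance** `C^K_{(Λ,Λ′]}(μ) = C^{K′}_{(Λ,Λ′]}(μ′)`. [folklore] -/
theorem hubbardCovSliceCT_eq_of_band (β h Λ Λ' : ℝ) (hX : nambuXiCT L μ K = nambuXiCT L μ' K') :
    hubbardCovSliceCT L M β μ h K Λ Λ' = hubbardCovSliceCT L M β μ' h K' Λ Λ' := by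
  simp only [hubbardCovSliceCT, hubbardCovAboveCT_eq_of_band β h Λ hX, hubbardCovAboveCT_eq_of_band β h Λ' hX]

variable [NeZero L]

/-- **The level shift at the band**: raising the chemical potential by `a` is subtracting the constant frame `−a`:
`nambuXiCT L (μ + a) K = nambuXiCT L μ (K ⊖ (−a))` (`(K ⊖ c)(p) = K(p) − c`, `eval_fsub_symInterp_const`). [folklore] -/
theorem nambuXiCT_level_shift (μ a : ℝ) (K : TrigPolyC4v) :
    nambuXiCT L (μ + a) K = nambuXiCT L μ (fsub K (symInterp L fun _ => -a)) := by
  funext k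
  simp only [nambuXiCT, eval_fsub_symInterp_const]
  ring

/-- The band of a frame with a constant subtracted: `e_{K ⊖ c}(k) = e_K(k) + c`. [folklore] -/
theorem nambuXiCT_fsub_symInterp_const (μ c : ℝ) (K : TrigPolyC4v) (k : TorusSite 2 L) :
    nambuXiCT L μ (fsub K (symInterp L fun _ => c)) k = nambuXiCT L μ K k + c := by
  simp only [nambuXiCT, eval_fsub_symInterp_const]
  ring

variable [NeZero M]

/-- **THE BASE IDENTIFICATION**: the band of the mean-free frame `K̊_{m₀} = K_{m₀} ⊖ s_{m₀}` at the shifted level `μ′ = μ + s_n` (`s_k = −Σ_{m<k} mean_m`)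
is the band at `μ` of `K♯ = K_{m₀} ⊖ c`, `c = Σ_{m₀ ≤ m < n} mean_m` (`m₀ ≤ n`). [folklore] -/
theorem nambuXiCT_meanFree_eq_base (β U μ : ℝ) {m₀ n : ℕ} (hmn : m₀ ≤ n) :
    nambuXiCT L (μ + -(∑ m ∈ range n, klAngularMean (klLocalPart L M β U μ (klFlowFrameU L M β U μ m) m)))
        (fsub (klFlowFrameU L M β U μ m₀) (symInterp L fun _ =>
          -(∑ m ∈ range m₀, klAngularMean (klLocalPart L M β U μ (klFlowFrameU L M β U μ m) m)))) =
      nambuXiCT L μ (fsub (klFlowFrameU L M β U μ m₀) (symInterp L fun _ =>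
          ∑ m ∈ Ico m₀ n, klAngularMean (klLocalPart L M β U μ (klFlowFrameU L M β U μ m) m))) := by
  funext k
  simp only [nambuXiCT, eval_fsub_symInterp_const]
  rw [← Finset.sum_range_add_sum_Ico _ hmn]
  ring

end Band

/-! ## §2 The base frame `K♯ = K_{m₀} ⊖ c` is admissible, from the current history -/

section Frame

variable {L M : ℕ} [NeZero L] [NeZero M]

/-- The order-`j ≥ 1` data of `K♯ = K_{m₀} ⊖ c` are those of `K_{m₀}` (frame shift). [folklore] -/
theorem iteratedFDeriv_frameShift_fsub_symInterp_const (K : TrigPolyC4v) (c : ℝ) {j : ℕ} (hj : j ≠ 0) (q : Momentum) :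
    iteratedFDeriv ℝ j (frameShift (fsub K (symInterp L fun _ => c))) q = iteratedFDeriv ℝ j (frameShift K) q := by
  have e : frameShift (fsub K (symInterp L fun _ => c)) = fun q => frameShift K q + (fun _ : Momentum => c) q := by
    funext q; simp only [frameShift, eval_fsub_symInterp_const]; ring
  rw [e, fun_iteratedFDeriv_add_apply (contDiff_frameShift K).contDiffAt contDiffAt_const, iteratedFDeriv_const_of_ne hj,
    Pi.zero_apply, add_zero]

/-- The order-`j ≥ 1` data of `K♯ = K_{m₀} ⊖ c` are those of `K_{m₀}` (band). [folklore] -/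
theorem iteratedFDeriv_frameLevel_fsub_symInterp_const (μ c : ℝ) (K : TrigPolyC4v) {j : ℕ} (hj : j ≠ 0) (q : Momentum) :
    iteratedFDeriv ℝ j (frameLevel μ (fsub K (symInterp L fun _ => c))) q = iteratedFDeriv ℝ j (frameLevel μ K) q := by
  have e : frameLevel μ (fsub K (symInterp L fun _ => c)) = fun q => frameLevel μ K q + (fun _ : Momentum => c) q := by
    funext q; simp only [frameLevel, eval_fsub_symInterp_const]; ring
  rw [e, fun_iteratedFDeriv_add_apply (contDiff_frameLevel μ K).contDiffAt contDiffAt_const, iteratedFDeriv_const_of_ne hj,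
    Pi.zero_apply, add_zero]

/-- **The δμ constants are within the order-0 allowance**: from the history's `RenormalisedAtF` slot at `m`,
`|mean_m| ≤ cr·klE0·|U|·4^{−2m}` (`Λ_m²/e₀ = e₀·16^{−m}`). [cite: BenfattoGiulianiMastropietro2006, §3 (3.3)] -/
theorem abs_klAngularMean_localPart_le_allowance {β U μ : ℝ} {R : RenConsts} {m : ℕ}
    (h : RenormalisedAtF L M β U μ (klFlowFrameU L M β U μ m) R m) :
    |klAngularMean (klLocalPart L M β U μ (klFlowFrameU L M β U μ m) m)| ≤ R.cr * klE0 * uPow 0 U * (4 : ℝ) ^ ((((0 : ℕ) : ℤ) - 2) * m) := by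
  have h0 := abs_klAngularMean_localPart_le_of_renormalisedAtF (L := L) (M := M) h
  have e : R.cr * |U| * klScale klE0 m ^ 2 / klE0 = R.cr * klE0 * uPow 0 U * (4 : ℝ) ^ ((((0 : ℕ) : ℤ) - 2) * m) := by
    have h4 : (4 : ℝ) ^ ((((0 : ℕ) : ℤ) - 2) * (m : ℤ)) = (((4 : ℝ) ^ m) ^ 2)⁻¹ := by
      rw [show (((0 : ℕ) : ℤ) - 2) * (m : ℤ) = -((2 * m : ℕ) : ℤ) by push_cast; ring, zpow_neg, zpow_natCast, pow_mul']
    rw [h4, uPow, if_pos rfl, klScale, klE0]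
    field_simp
  rw [← e]; exact h0

set_option maxHeartbeats 800000 in -- one long bookkeeping proof: piece decomposition + three allowance sums
/-- **The mean-free base frame is admissible**: `FrameOK R♭ U (nScales β) μ (K_{m₀} ⊖ c)`, `c = Σ_{m₀≤m<n} mean_m`, `R♭ = ⟨cr, cz, Gfr[0 ↦ Gfr₀ + cr·klE0]⟩`,
from the current history (`1 ≤ m₀ ≤ n ≤ n_β + 1`), the window, `IsKLRegime U cc (−n)` with `cc ≤ 1/(480(Gfr₂+1))`, and ONE own door
`U ≤ 1/(2¹²·(Gfr₀ + Gfr₁ + cr + 1))` (see the module docstring). [cite: BenfattoGiulianiMastropietro2006, §3 (3.2)–(3.8)] -/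
theorem frameOK_meanFreeBase {R : RenConsts} (hR2 : R.WF2) {G : GeoConsts} {P : SplitConsts} {Q : EngConsts} {β U μ cc : ℝ}
    (hμ : μ ∈ klWindowC) (hU : 0 < U) (hU1 : U ≤ 1) (hUd : U ≤ 1 / (2 ^ 12 * (R.Gfr 0 + R.Gfr 1 + R.cr + 1)))
    (hcc : 0 ≤ cc) (hcc2 : cc ≤ 1 / (480 * (R.Gfr 2 + 1)))
    {n m₀ : ℕ} (hreg : IsKLRegime U cc (-(n : ℤ))) (hm1 : 1 ≤ m₀) (hmn : m₀ ≤ n) (hnN : n ≤ nScales β + 1)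
    (hhist : HistP klPredsV17F2 L M G P Q R β U μ 0 n) :
    FrameOK ⟨R.cr, R.cz, fun j => if j = 0 then R.Gfr 0 + R.cr * klE0 else R.Gfr j⟩ U (nScales β) μ
      (fsub (klFlowFrameU L M β U μ m₀)
        (symInterp L fun _ => ∑ m ∈ Ico m₀ n, klAngularMean (klLocalPart L M β U μ (klFlowFrameU L M β U μ m) m))) := by
  have hRj : ∀ j, 0 ≤ R.Gfr j := hR2.1.2.2
  have hcr : 0 ≤ R.cr := hR2.1.1
  have he : (0 : ℝ) < klE0 := by norm_num [klE0]
  have he1 : klE0 ≤ 1 := by norm_num [klE0]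
  -- local arithmetic: `1 < log 4`, the exponent shapes at orders 0/1/2, the two geometric sums
  have one_lt_log_four : (1 : ℝ) < Real.log 4 := by
    rw [Real.lt_log_iff_exp_lt (by norm_num)]
    have := Real.exp_one_lt_d9
    linarith
  have zpow_order_zero : ∀ m : ℕ, (4 : ℝ) ^ ((((0 : ℕ) : ℤ) - 2) * (m : ℤ)) = ((16 : ℝ)⁻¹) ^ m := fun m => by
    rw [show (((0 : ℕ) : ℤ) - 2) * (m : ℤ) = -((2 * m : ℕ) : ℤ) by push_cast; ring, zpow_neg, zpow_natCast, pow_mul, inv_pow]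
    norm_num
  have zpow_order_one : ∀ m : ℕ, (4 : ℝ) ^ ((((1 : ℕ) : ℤ) - 2) * (m : ℤ)) = ((4 : ℝ)⁻¹) ^ m := fun m => by
    rw [show (((1 : ℕ) : ℤ) - 2) * (m : ℤ) = -((m : ℕ) : ℤ) by push_cast; ring, zpow_neg, zpow_natCast, inv_pow]
  have zpow_order_two : ∀ m : ℕ, (4 : ℝ) ^ ((((2 : ℕ) : ℤ) - 2) * (m : ℤ)) = 1 := fun m => by
    rw [show (((2 : ℕ) : ℤ) - 2) * (m : ℤ) = 0 by push_cast; ring, zpow_zero]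
  have geom_sixteenth_le : ∀ k : ℕ, ∑ m ∈ range k, ((16 : ℝ)⁻¹) ^ m ≤ 16 / 15 := fun k => by
    have h := geom_sum_Ico_le_of_lt_one (m := 0) (n := k) (x := (16 : ℝ)⁻¹) (by norm_num) (by norm_num)
    rw [← Finset.range_eq_Ico] at h; exact h.trans (by norm_num)
  have geom_quarter_le : ∀ k : ℕ, ∑ m ∈ range k, ((4 : ℝ)⁻¹) ^ m ≤ 4 / 3 := fun k => by
    have h := geom_sum_Ico_le_of_lt_one (m := 0) (n := k) (x := (4 : ℝ)⁻¹) (by norm_num) (by norm_num)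
    rw [← Finset.range_eq_Ico] at h; exact h.trans (by norm_num)
  -- the bumped package
  set Rb : RenConsts := ⟨R.cr, R.cz, fun j => if j = 0 then R.Gfr 0 + R.cr * klE0 else R.Gfr j⟩ with hRb
  have hRb0 : Rb.Gfr 0 = R.Gfr 0 + R.cr * klE0 := by simp [hRb]
  have hRbj : ∀ j, j ≠ 0 → Rb.Gfr j = R.Gfr j := fun j hj => by simp [hRb, hj]
  have hRle : ∀ j, R.Gfr j ≤ Rb.Gfr j := by
    intro j
    by_cases hj : j = 0
    · subst hj; rw [hRb0]; nlinarith [hcr, he]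
    · rw [hRbj j hj]
  have hRbnn : ∀ j, 0 ≤ Rb.Gfr j := fun j => (hRj j).trans (hRle j)
  -- the history: jets at every `m < n`, renormalisation (hence the δμ constants) at every `m < n`
  obtain ⟨N, rfl⟩ : ∃ N, n = N + 1 := ⟨n - 1, by omega⟩
  have hh := (histP_klPredsV17F2_iff L M G P Q R β U μ 0 (N + 1)).1 hhist
  have hJ : ∀ m ≤ N, FlowPieceJetsAt L M β U μ R m := fun m hm => (hh m (Nat.lt_succ_of_le hm)).2.1.2.1
  have hRen : ∀ m ≤ N, RenormalisedAtF L M β U μ (klFlowFrameU L M β U μ m) R m := fun m hm => (hh m (Nat.lt_succ_of_le hm)).2.1.1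
  -- abbreviations
  set mean : ℕ → ℝ := fun m => klAngularMean (klLocalPart L M β U μ (klFlowFrameU L M β U μ m) m) with hmean
  set bd : ℕ → ℕ → ℝ := fun j m => Rb.Gfr j * uPow j U * (4 : ℝ) ^ (((j : ℤ) - 2) * m) with hbd_def
  have hbd : ∀ j m, 0 ≤ bd j m := fun j m => mul_nonneg (mul_nonneg (hRbnn j) (uPow_nonneg j U)) (zpow_nonneg (by norm_num) _)
  have hu0 : uPow 0 U = U := by rw [uPow, if_pos rfl, abs_of_pos hU]
  have hune : ∀ j, j ≠ 0 → uPow j U = U ^ 2 := fun j hj => by rw [uPow, if_neg hj]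
  -- the δμ constants are within the order-0 allowance of `Rb`
  have hmean_le : ∀ m ≤ N, |mean m| ≤ bd 0 m := by
    intro m hm
    refine (abs_klAngularMean_localPart_le_allowance (hRen m hm)).trans ?_
    simp only [hbd_def, hRb0]
    have h4 : 0 ≤ (4 : ℝ) ^ ((((0 : ℕ) : ℤ) - 2) * (m : ℤ)) := zpow_nonneg (by norm_num) _
    have : R.cr * klE0 ≤ R.Gfr 0 + R.cr * klE0 := by linarith [hRj 0]
    exact mul_le_mul_of_nonneg_right (mul_le_mul_of_nonneg_right this (uPow_nonneg 0 U)) h4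
  -- (ii) the piece decomposition of `K♯`
  set Kp : ℕ → TrigPolyC4v := fun m => if m < m₀ then fsub 0 (klFlowPiece L M β U μ m) else symInterp L fun _ => -mean m with hKp
  have hKp_jet : ∀ m ≤ N, ∀ j ≤ 4, ∀ q : Momentum, ‖iteratedFDeriv ℝ j (evalM (Kp m)) q‖ ≤ Rb.Gfr j * uPow j U * (4 : ℝ) ^ (((j : ℤ) - 2) * m) := by
    intro m hm j hj q
    by_cases hlt : m < m₀
    · simp only [hKp, if_pos hlt]
      rw [evalM_fsub_zero, iteratedFDeriv_neg_apply, norm_neg]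
      exact (hJ m hm j hj q).trans (mul_le_mul_of_nonneg_right (mul_le_mul_of_nonneg_right (hRle j) (uPow_nonneg j U))
        (zpow_nonneg (by norm_num) _))
    · simp only [hKp, if_neg hlt]
      rw [evalM_symInterp_const]
      by_cases hj0 : j = 0
      · subst hj0
        rw [iteratedFDeriv_zero_eq_comp, Function.comp_apply, LinearIsometryEquiv.norm_map, Real.norm_eq_abs, abs_neg]
        exact hmean_le m hm
      · rw [iteratedFDeriv_const_of_ne hj0, Pi.zero_apply, norm_zero]
        exact mul_nonneg (mul_nonneg (hRbnn j) (uPow_nonneg j U)) (zpow_nonneg (by norm_num) _)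
  have hKp_eval : ∀ p : Fin 2 → ℝ, (fsub (klFlowFrameU L M β U μ m₀) (symInterp L fun _ => ∑ m ∈ Ico m₀ (N + 1), mean m)).eval p =
      ∑ m ∈ range (N + 1), (Kp m).eval p := by
    intro p
    rw [eval_fsub_symInterp_const, eval_klFlowFrameU, ← Finset.sum_range_add_sum_Ico _ hmn]
    have h1 : ∑ m ∈ range m₀, (Kp m).eval p = ∑ m ∈ range m₀, -(klFlowPiece L M β U μ m).eval p :=
      Finset.sum_congr rfl fun m hm => by
        simp only [hKp, if_pos (Finset.mem_range.1 hm), eval_fsub, TrigPolyC4v.eval_zero, zero_sub]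
    have h2 : ∑ m ∈ Ico m₀ (N + 1), (Kp m).eval p = ∑ m ∈ Ico m₀ (N + 1), -mean m :=
      Finset.sum_congr rfl fun m hm => by
        have : ¬ m < m₀ := not_lt.2 (Finset.mem_Ico.1 hm).1
        simp only [hKp, if_neg this, eval_symInterp_const]
    rw [h1, h2, Finset.sum_neg_distrib, Finset.sum_neg_distrib]
    ring
  -- (i) the geometry: pieces of the FRAME SHIFT (opposite sign), allowance sums
  set Kq : ℕ → TrigPolyC4v := fun m => if m < m₀ then klFlowPiece L M β U μ m else symInterp L fun _ => mean m with hKq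
  have hKq_jet : ∀ m ≤ N, ∀ j ≤ 2, ∀ q : Momentum, ‖iteratedFDeriv ℝ j (evalM (Kq m)) q‖ ≤ bd j m := by
    intro m hm j hj q
    simp only [hbd_def]
    by_cases hlt : m < m₀
    · simp only [hKq, if_pos hlt]
      exact (hJ m hm j (hj.trans (by norm_num)) q).trans (mul_le_mul_of_nonneg_right
        (mul_le_mul_of_nonneg_right (hRle j) (uPow_nonneg j U)) (zpow_nonneg (by norm_num) _))
    · simp only [hKq, if_neg hlt]
      rw [evalM_symInterp_const]
      by_cases hj0 : j = 0
      · subst hj0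
        rw [iteratedFDeriv_zero_eq_comp, Function.comp_apply, LinearIsometryEquiv.norm_map, Real.norm_eq_abs]
        exact hmean_le m hm
      · rw [iteratedFDeriv_const_of_ne hj0, Pi.zero_apply, norm_zero]
        exact mul_nonneg (mul_nonneg (hRbnn j) (uPow_nonneg j U)) (zpow_nonneg (by norm_num) _)
  have hKq_sum : frameShift (fsub (klFlowFrameU L M β U μ m₀) (symInterp L fun _ => ∑ m ∈ Ico m₀ (N + 1), mean m)) =
      fun q => ∑ m ∈ range (N + 1), evalM (Kq m) q := by
    funext q
    rw [frameShift]
    show -((fsub (klFlowFrameU L M β U μ m₀) (symInterp L fun _ => ∑ m ∈ Ico m₀ (N + 1), mean m)).eval (WithLp.ofLp q)) = _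
    rw [hKp_eval]
    rw [← Finset.sum_neg_distrib]
    refine Finset.sum_congr rfl fun m _ => ?_
    by_cases hlt : m < m₀
    · simp only [hKp, hKq, if_pos hlt, evalM_apply, eval_fsub, TrigPolyC4v.eval_zero, zero_sub, neg_neg]
    · simp only [hKp, hKq, if_neg hlt, evalM_apply, eval_symInterp_const, neg_neg]
  -- the door: `X·U ≤ 2⁻¹²` for `X = Gfr₀ + Gfr₁ + cr`
  have hX0 : 0 ≤ R.Gfr 0 + R.Gfr 1 + R.cr := by linarith [hRj 0, hRj 1]
  have hdoor : (R.Gfr 0 + R.Gfr 1 + R.cr) * U ≤ 1 / 2 ^ 12 := by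
    have h1 : (R.Gfr 0 + R.Gfr 1 + R.cr) * U ≤ (R.Gfr 0 + R.Gfr 1 + R.cr) * (1 / (2 ^ 12 * (R.Gfr 0 + R.Gfr 1 + R.cr + 1))) :=
      mul_le_mul_of_nonneg_left hUd hX0
    refine h1.trans ?_
    rw [← mul_div_assoc, mul_one, div_le_div_iff₀ (by positivity) (by positivity)]
    nlinarith [hX0]
  -- order 0: `Σ bd 0 ≤ (16/15)(Gfr₀ + cr·e₀)U ≤ (16/15)·2⁻¹²`
  have hsum0 : ∑ m ∈ range (N + 1), bd 0 m ≤ 16 / 15 * (1 / 2 ^ 12) := by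
    have e0 : ∀ m, bd 0 m = (R.Gfr 0 + R.cr * klE0) * U * ((16 : ℝ)⁻¹) ^ m := fun m => by
      simp only [hbd_def, hRb0, hu0, zpow_order_zero]
    simp_rw [e0]
    rw [← Finset.mul_sum]
    have hA : (R.Gfr 0 + R.cr * klE0) * U ≤ 1 / 2 ^ 12 := by
      have : (R.Gfr 0 + R.cr * klE0) * U ≤ (R.Gfr 0 + R.Gfr 1 + R.cr) * U :=
        mul_le_mul_of_nonneg_right (by nlinarith [hRj 1, hcr, he1]) hU.le
      exact this.trans hdoor
    have hA0 : 0 ≤ (R.Gfr 0 + R.cr * klE0) * U := by have := hRj 0; positivity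
    calc (R.Gfr 0 + R.cr * klE0) * U * ∑ m ∈ range (N + 1), ((16 : ℝ)⁻¹) ^ m ≤ (R.Gfr 0 + R.cr * klE0) * U * (16 / 15) :=
          mul_le_mul_of_nonneg_left (geom_sixteenth_le _) hA0
      _ ≤ 1 / 2 ^ 12 * (16 / 15) := mul_le_mul_of_nonneg_right hA (by norm_num)
      _ = 16 / 15 * (1 / 2 ^ 12) := by ring
  -- order 1: `Σ bd 1 ≤ (4/3)Gfr₁U² ≤ (4/3)·2⁻¹²`
  have hsum1 : ∑ m ∈ range (N + 1), bd 1 m ≤ 4 / 3 * (1 / 2 ^ 12) := by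
    have e1 : ∀ m, bd 1 m = R.Gfr 1 * U ^ 2 * ((4 : ℝ)⁻¹) ^ m := fun m => by
      simp only [hbd_def, hRbj 1 one_ne_zero, hune 1 one_ne_zero, zpow_order_one]
    simp_rw [e1]
    rw [← Finset.mul_sum]
    have hB : R.Gfr 1 * U ^ 2 ≤ 1 / 2 ^ 12 := by
      have h1 : R.Gfr 1 * U ^ 2 ≤ R.Gfr 1 * U := by
        have := mul_le_mul_of_nonneg_left hU1 (mul_nonneg (hRj 1) hU.le)
        calc R.Gfr 1 * U ^ 2 = R.Gfr 1 * U * U := by ring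
          _ ≤ R.Gfr 1 * U * 1 := this
          _ = R.Gfr 1 * U := mul_one _
      have h2 : R.Gfr 1 * U ≤ (R.Gfr 0 + R.Gfr 1 + R.cr) * U :=
        mul_le_mul_of_nonneg_right (by linarith [hRj 0, hcr]) hU.le
      exact (h1.trans h2).trans hdoor
    have hB0 : 0 ≤ R.Gfr 1 * U ^ 2 := by have := hRj 1; positivity
    calc R.Gfr 1 * U ^ 2 * ∑ m ∈ range (N + 1), ((4 : ℝ)⁻¹) ^ m ≤ R.Gfr 1 * U ^ 2 * (4 / 3) := mul_le_mul_of_nonneg_left (geom_quarter_le _) hB0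
      _ ≤ 1 / 2 ^ 12 * (4 / 3) := mul_le_mul_of_nonneg_right hB (by norm_num)
      _ = 4 / 3 * (1 / 2 ^ 12) := by ring
  -- order 2: `Σ bd 2 = n·Gfr₂U² ≤ Gfr₂·cc/log 4 ≤ 1/480` by the KL regime
  have hsum2 : ∑ m ∈ range (N + 1), bd 2 m ≤ 1 / 480 := by
    have e2 : ∀ m, bd 2 m = R.Gfr 2 * U ^ 2 := fun m => by
      simp only [hbd_def, hRbj 2 two_ne_zero, hune 2 two_ne_zero, zpow_order_two, mul_one]
    simp_rw [e2]
    rw [Finset.sum_const, Finset.card_range, nsmul_eq_mul]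
    have hr := hreg.mul_le (hRj 2)
    rw [show |((-((N + 1 : ℕ) : ℤ) : ℤ) : ℝ)| = (N + 1 : ℕ) by push_cast; rw [abs_neg]; exact abs_of_nonneg (by positivity)] at hr
    have hlog : R.Gfr 2 * cc / Real.log 4 ≤ R.Gfr 2 * cc := by
      rw [div_le_iff₀ (lt_trans one_pos one_lt_log_four)]
      have : 0 ≤ R.Gfr 2 * cc := mul_nonneg (hRj 2) hcc
      nlinarith [one_lt_log_four]
    have hG2 : R.Gfr 2 * cc ≤ 1 / 480 := by
      calc R.Gfr 2 * cc ≤ R.Gfr 2 * (1 / (480 * (R.Gfr 2 + 1))) := mul_le_mul_of_nonneg_left hcc2 (hRj 2)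
        _ = R.Gfr 2 / (R.Gfr 2 + 1) / 480 := by field_simp
        _ ≤ 1 / 480 := by
            have : R.Gfr 2 / (R.Gfr 2 + 1) ≤ 1 := by rw [div_le_one (by linarith [hRj 2])]; linarith
            linarith
    calc ((N + 1 : ℕ) : ℝ) * (R.Gfr 2 * U ^ 2) = R.Gfr 2 * U ^ 2 * ((N + 1 : ℕ) : ℝ) := by ring
      _ ≤ R.Gfr 2 * cc / Real.log 4 := hr
      _ ≤ 1 / 480 := hlog.trans hG2
  have h0 : ∑ m ∈ range (N + 1), bd 0 m ≤ 3 / 80 := hsum0.trans (by norm_num)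
  have h1 : ∑ m ∈ range (N + 1), bd 1 m ≤ 1 / 2000 := hsum1.trans (by norm_num)
  have h2 : ∑ m ∈ range (N + 1), ∑ j ∈ range 3, bd j m ≤ 1 / 100 := by
    have e : ∑ m ∈ range (N + 1), ∑ j ∈ range 3, bd j m =
        ∑ m ∈ range (N + 1), bd 0 m + ∑ m ∈ range (N + 1), bd 1 m + ∑ m ∈ range (N + 1), bd 2 m := by
      rw [← Finset.sum_add_distrib, ← Finset.sum_add_distrib]
      refine Finset.sum_congr rfl fun m _ => ?_
      simp [Finset.sum_range_succ]
    rw [e]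
    linarith [hsum0, hsum1, hsum2]
  have hμ' : μ ∈ Set.Icc (-1.05 : ℝ) (-0.15) := hμ
  have hgeom := geomConstants_of_pieces hμ' hbd hKq_sum hKq_jet h0 h1 h2
  -- assemble at depth `N`, then raise to `nScales β`
  have hOK : FrameOK Rb U N μ (fsub (klFlowFrameU L M β U μ m₀) (symInterp L fun _ => ∑ m ∈ Ico m₀ (N + 1), mean m)) :=
    ⟨hgeom, Kp, hKp_eval, hKp_jet⟩
  exact FrameOK.mono hRbnn (by omega) hOK

end Frame

end Summit.HubbardSuperconductivity.HubbardSuperconductivity.Theorems.KLRegimeSplit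

end
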